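import Mathlib
import Literature.Analysis.FunctionSpaces.PVTheory
import Literature.Analysis.FunctionSpaces.PVTrueUniversal
import Literature.Computability.Complexity.CNF
import Literature.Computability.MetaComplexity.ProofSystems
import Summits.PneNP.PneNP.Theorems.LatticeMagicTargetDefs
import HarnessLib
import Summits.PneNP.PneNP.Theorems.LatticeMagicTargetSqueezeAssembly
import Summits.PneNP.PneNP.Theorems.LatticeMagicTargetIffProofcplxThesis
import Literature.Computability.MetaComplexity.EFSoundness
import Literature.Computability.Complexity.ProofComplexityNP

/-!
# Line `KrajicekSplit` — crux `Target` of route LatticeMagic (stmt-PneNP-10709) — crux-strategist DECOMPOSITION (EXEMPT-46 fix)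

Self-contained skeleton (planners cannot land Theorems files): §§1–5 = the vocabulary that is proposed for
`Theorems/LatticeMagicTargetPieces.lean`; the join/assembly lemmas = the proposed
`Theorems/LatticeMagicTargetSplit.lean`; §6 = the three REGISTERED STUBS (= the route pieces
`HypothesisST`, `KrajicekMEP`, `KrajicekSqueeze`) and the kernel-checked composition `Target_of`.
Everything outside `stub_*` is sorry-free.

# (Pieces) Route LatticeMagic, crux `Target` (stmt-PneNP-10709): the PIECES of Krajíček's squeeze, with MEP un-folded

Vocabulary for the typed decomposition of the crux `Summit.PneNP.PneNP.Theses.LatticeMagic.Target`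
(`⟺ NP ≠ coNP`) along J. Krajíček, *A proof complexity conjecture and the Incompleteness theorem*,
JSL 2023 = arXiv:2506.20221 (Thm 4.1: "Problem 3.2 affirmative ⟹ ((ST) ⟹ NP ≠ coNP)"), crux-strategist
pass `cstrat-stmt-PneNP-10709-r1` (EXEMPT-46 fix: the model-extension property MEP = Problem 3.2 becomes
its own typed piece instead of being folded into the stub `stub_squeeze` of line `SketchIdeator5`).

The earlier seats recorded MEP as "not statable in the tree (no `L_PV`-structures ⊨ `T_PV`, no `‖·‖ⁿ`)".
The first half is no longer true: the tree has the language `L(PV)` (`FirstOrder.Language.pv`, one symbol per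
description in Cobham's algebra, `PVTheory.lean`), Krajíček's `T_PV` VERBATIM as
`Literature.Analysis.FunctionSpaces.trueUnivPV` (all universal `L(PV)`-sentences true in `ℕ`,
`PVTrueUniversal.lean`), the class `Σᵇ₁(PV)` (`IsSigmabPV 1`), and Cobham's theorem PROVED
(`cobham_holds`: `PV`-definable = polynomial time on binary notation). Problem 3.2 needs nothing else:
Mathlib supplies `L`-embeddings and `Theory.Model`. (The translation `‖·‖ⁿ` is needed for the PROOF of
Thm 4.1, not for stating MEP.) This file defines, sorry-free and computation-free:

* §1 numbers as strings and as propositional formulas (`strOfNat`, `flaOfNat`, total decoding: a number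
  whose string is not a formula code names `⊥`), the falsification function `falsifiesFn`
  ("assignment `y` falsifies formula `a`", so that `¬φ ∈ SAT` reads `∃ y, fal(φ, y) = 1`), and
  `IsSoundProofSymbol` (a binary `PV` symbol that, in `ℕ`, accepts only proofs of tautologies — the
  relational form of an arbitrary Cook–Reckhow proof system, cf. Krajíček 2019 Def. 1.5.1);
* §2 `pvOne`, `pvLen` (the elements `1`, `|x|` of an `L(PV)`-structure), `NoProofInModel M φ` —
  CONDITION 1 of Krajíček's Thm 3.1 ("`φ` has no proof in `M` in any proof system");
* §3 `ModelExtensionProperty` — **MEP, the affirmative answer to Problem 3.2**, typed schematically in the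
  `PV` symbol `fal` for `falsifiesFn` (any two such symbols are `T_PV`-provably equal, so the schematic
  form is the specific one; a symbol exists by `cobham_holds`);
* §4 `StrongFDP V` — the strong feasible disjunction property of a proof system over the tree's `DD_V`
  vocabulary (`DDInstance`, `bigDisj` of `LatticeMagicTargetDefs.lean`), the property whose failure for
  ST-hard strong systems is the "somewhat stronger conclusion" of the proof of Thm 4.1 (arXiv:2506.20221,
  last paragraph of §4).

Nothing here is a claim; the claims are the route items filed over these notions
(`Theorems/LatticeMagicTargetSplit.lean` for the assembly).
-/

set_option linter.dupNamespace false -- `Summit.PneNP.PneNP.…`: summit = sub-problem (D-0017)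

namespace Summit.PneNP.PneNP.Cruxes.Target.KrajicekSplit

open FirstOrder FirstOrder.Language
open Literature.Analysis.FunctionSpaces Literature.Computability.Complexity
open Literature.Computability.MetaComplexity
open _root_.Computability
open Summit.PneNP.PneNP.Theorems Summit.PneNP.PneNP.Theorems.LatticeMagicTarget

/-! ### 1. Numbers as strings, strings as formulas -/

/-- The bit string named by the number `n`: the binary notation of `n + 1` (Mathlib `encodeNat`,
least significant bit first, so it ends in the leading bit `1`) with that final `1` removed. This is
the dyadic bijection `ℕ ≃ {0,1}*` (`0 ↦ ε, 1 ↦ 0, 2 ↦ 1, 3 ↦ 00, …`), of linear distortion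
`|strOfNat n| = |n + 1| − 1`, hence harmless for polynomial time on binary notation (the convention of
`cobham_holds`). [folklore] -/
def strOfNat (n : ℕ) : List Bool :=
  (encodeNat (n + 1)).dropLast

/-- The number naming the bit string `w` (inverse of `strOfNat`): read `w` followed by a leading `1`
as a positive binary number and subtract one. [folklore] -/
def natOfStr (w : List Bool) : ℕ :=
  decodeNat (w ++ [true]) - 1

/-- The propositional formula coded by the number `n`, with TOTAL decoding: if `strOfNat n` is not the
code of a formula (`encodingPropForm`, `CNF.lean`) the number names the falsum `⊥` — a non-tautology
falsified by every assignment, so that junk codes neither have proofs in sound systems nor obstruct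
satisfiability of their negation. [folklore] -/
def flaOfNat (n : ℕ) : PropForm ℕ :=
  (encodingPropForm.decode (strOfNat n)).getD (PropForm.const false)

/-- The number coding the formula `φ`. [folklore] -/
def natOfFla (φ : PropForm ℕ) : ℕ :=
  natOfStr (encodingPropForm.encode φ)

/-- **Falsification**, the polynomial-time function behind "`¬φ ∈ SAT`": `falsifiesFn a y = 1` iff the
string of `y`, read as a truth assignment (`i ↦ (strOfNat y)_i`, `false` beyond its length), gives the
formula coded by `a` the value `false`; otherwise `0`. (Polynomial time on binary notation: decode,
evaluate; hence the interpretation of some `PV` symbol by `cobham_holds` — not needed to STATE anything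
below.) [folklore] -/
def falsifiesFn (a y : ℕ) : ℕ :=
  if (flaOfNat a).eval (fun i => (strOfNat y).getD i false) = false then 1 else 0

/-- A binary `PV` symbol `prf` is a **sound proof predicate** in the standard model: whenever
`prf(x, a) = 1` ("`x` is a proof of `a`"), the formula coded by `a` is a tautology. This is the
relational form of "an arbitrary propositional proof system" (Cook–Reckhow function `P` ↦ the predicate
`[P(x) = a]`, a `PV` symbol by Cobham's theorem; predicate `R` ↦ the function
`⟨x, a⟩ ↦ if R(x, a) then a else ⌜⊤⌝`); completeness plays no role in "`φ` has a proof".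
[cite: Krajicek2019, Def. 1.5.1] -/
def IsSoundProofSymbol (prf : PVFun 2) : Prop :=
  ∀ x a : ℕ, prf.eval ![x, a] = 1 → (flaOfNat a).IsTautology

/-! ### 2. Inside an `L(PV)`-structure -/

section Structures

variable (K : Type) [Language.pv.Structure K]

/-- The element `1 = s₁(0)` of an `L(PV)`-structure. [folklore] -/
def pvOne : K :=
  papp (PVFun.bit true) ![papp PVFun.zero ![] ]

variable {K}

/-- The length `|x|` of an element of an `L(PV)`-structure (the symbol `len`). [folklore] -/
def pvLen (x : K) : K :=
  papp PVFun.len ![x]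

/-- In the standard model, `pvOne ℕ = 1`. [folklore] -/
@[simp] theorem pvOne_nat : pvOne ℕ = 1 := by
  simp [pvOne, papp]

/-- In the standard model, `pvLen n = Nat.size n = |n|`. [folklore] -/
@[simp] theorem pvLen_nat (n : ℕ) : pvLen n = Nat.size n := by
  simp [pvLen, papp]

end Structures

/-- **Condition 1** of Krajíček's Thm 3.1 (after Krajíček–Pudlák, *Propositional provability in models
of weak arithmetic*, CSL '89): the element `φ` (a propositional formula in the sense of the model `M`)
**has no proof in `M` in any proof system** — for every sound proof predicate `prf` (a standard proof
system; its proofs `x` range over ALL of `M`, of any non-standard length) `M ⊨ ∀ x, prf(x, φ) ≠ 1`.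
[cite: Krajicek2025Squeeze, Thm. 3.1] -/
def NoProofInModel (M : Type) [Language.pv.Structure M] (φ : M) : Prop :=
  ∀ prf : PVFun 2, IsSoundProofSymbol prf → ∀ x : M, papp prf ![x, φ] ≠ pvOne M

/-! ### 3. MEP — Krajíček's Problem 3.2 -/

/-- **MEP, the model-extension property for `T_PV` = the affirmative answer to Krajíček's Problem 3.2**
(arXiv:2506.20221, §3). For every model `M ⊨ T_PV` (`trueUnivPV`: all true universal `L(PV)`-sentences)
and every `φ ∈ M` that has no proof in `M` in any proof system (`NoProofInModel`, Condition 1 of Thm 3.1),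
there are `L(PV)`-structures `M ⊆ M* ⊆ M'` (embeddings `e`, `f`) such that
* `M*` preserves from `M` all `Σᵇ₁(PV)`-properties of elements (`IsSigmabPV 1` formulas, any arity),
* `M' ⊨ T_PV + ¬φ ∈ SAT` (some `y ∈ M'` falsifies `φ`: `fal(φ, y) = 1`),
* `Log(M*) = Log(M')` (every length of `M'` is the length of an element of `M*`; `⊆` is automatic).
Typed SCHEMATICALLY in the symbol `fal` computing `falsifiesFn` in `ℕ`: `T_PV` proves any two such
symbols equal, so the statement does not depend on the choice, and a symbol exists by Cobham's theorem
(`cobham_holds`). STATUS: OPEN ("it is open at present if it holds", loc. cit. abstract); known for models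
of `S¹₂`/`BB` (Krajíček–Pudlák 1990, by the sharply bounded collection scheme) and, with the `Log`
clause, by the forcing of Krajíček 1995 §9.4 under an extra hypothesis on `M`; the NEGATIVE answer
implies `P ≠ NP` (loc. cit.: otherwise `T_PV ⊢ S¹₂(PV)`). By Thm 4.1, MEP ∧ (ST) ⟹ `NP ≠ coNP`.
[cite: Krajicek2025Squeeze, Problem 3.2] -/
def ModelExtensionProperty : Prop :=
  ∀ fal : PVFun 2, (∀ a y : ℕ, fal.eval ![a, y] = falsifiesFn a y) →
    ∀ (M : Type) [Language.pv.Structure M] [M ⊨ trueUnivPV] (φ : M), NoProofInModel M φ →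
      ∃ (Ms : Type) (_ : Language.pv.Structure Ms) (M' : Type) (_ : Language.pv.Structure M')
        (e : M ↪[Language.pv] Ms) (f : Ms ↪[Language.pv] M'),
        M' ⊨ trueUnivPV ∧
        (∀ (k : ℕ) (θ : Language.pv.Formula (Fin k)), IsSigmabPV 1 θ →
          ∀ v : Fin k → M, θ.Realize v → θ.Realize (e ∘ v)) ∧
        (∃ y : M', papp fal ![f (e φ), y] = pvOne M') ∧
        (∀ y : M', ∃ x : Ms, pvLen (f x) = pvLen y)

/-! ### 4. The strong feasible disjunction property -/

/-- **Strong feasible disjunction property** of a proof system `V` (Krajíček, *Proof complexity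
generators*, CUP 2025; arXiv:2506.20221 §4, closing remark): from a `V`-proof `π` of a DISJOINT
disjunction `⋁ l` (the tree's `DDInstance V`: pairwise variable-disjoint disjuncts) some disjunct has a
`V`-proof at most polynomially longer — one polynomial `p` for all instances, the bound taken in
`|π| + |⋁ l|`. A polynomially bounded proof system for `TAUT` has it trivially (some disjunct of a
tautological disjoint disjunction is a tautology, `exists_isTautology_of_bigDisj`). Krajíček's proof of
Thm 4.1 shows: MEP ⟹ no strong proof system with an ST-hard `DD` problem has this property.
[cite: Krajicek2025Squeeze, §4 (closing remark)] -/
def StrongFDP (V : List Bool → List Bool → Bool) : Prop :=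
  ∃ p : Polynomial ℕ, ∀ I : DDInstance V, ∃ φ ∈ I.l, ∃ π' : List Bool,
    π'.length ≤ p.eval (I.π.length + (encodingPropForm.encode (bigDisj I.l)).length) ∧
      V (encodingPropForm.encode φ) π' = true

/-! ### 5. Sanity of the coding conventions (standard model, small cases by evaluation) -/

/-- The dyadic coding on small numbers: `0 ↦ ε, 1 ↦ 0, 2 ↦ 1, 3 ↦ 00, 4 ↦ 10, 6 ↦ 11`
(least significant bit first). [folklore] -/
example : strOfNat 0 = [] ∧ strOfNat 1 = [false] ∧ strOfNat 2 = [true] ∧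
    strOfNat 3 = [false, false] ∧ strOfNat 4 = [true, false] ∧ strOfNat 6 = [true, true] := by
  decide

/-- `natOfStr` inverts `strOfNat` (checked by evaluation on an initial segment). [folklore] -/
example : ∀ n < 40, natOfStr (strOfNat n) = n := by
  decide

/-- `falsifiesFn` computes falsification: the all-false assignment (`y = 0`, string `ε`) falsifies
the variable `x₀` and does not falsify `¬x₀`; every assignment falsifies `⊥`. [folklore] -/
example : falsifiesFn (natOfFla (PropForm.var 0)) 0 = 1 ∧
    falsifiesFn (natOfFla (PropForm.neg (PropForm.var 0))) 0 = 0 ∧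
    falsifiesFn (natOfFla (PropForm.const false)) 5 = 1 := by
  native_decide

end Summit.PneNP.PneNP.Cruxes.Target.KrajicekSplit


/-!
# Route LatticeMagic, crux `Target` (stmt-PneNP-10709) — the TYPED SPLIT of the crux along Krajíček's squeeze

`Target` (⟺ `NP ≠ coNP`) follows from three pieces, assembled here SORRY-FREE:

* **A = Hypothesis (ST)** (Krajíček, arXiv:2506.20221 §2, VERBATIM: some strong — EF-simulating —
  Cook–Reckhow proof system for `TAUT` has its disjoint-disjunction search problem `DD_V` hard for
  p-time students with `O(1)` rounds; open; evidence: Lemma 2.2 (one-way permutations) and the landed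
  `st_of_injOWF` (an injective one-way family with a hard-core bit gives the EF-free form); PRICE TAG:
  (ST) refutes `TAUT ∈ P`, hence proves the summit `PneNP` — landed `Target.Negative.pneNP_of_stHyp`);
* **M = `ModelExtensionProperty`** (open: Krajíček's Problem 3.2, typed in `LatticeMagicTargetPieces.lean`);
* **K = Krajíček's Thm 4.1 in its strong form** (a theorem in print, arXiv:2506.20221 §4 incl. the closing
  remark): MEP ⟹ no STRONG (⊇ EF) Cook–Reckhow proof system for `TAUT` with an ST-hard `DD`-problem has
  the strong feasible disjunction property.

The assembly `latticeMagicTarget_of_pieces : A → M → K → Target` is Krajíček's step (1) of the proof of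
Thm 4.1 done in Lean (core form `latticeMagicTarget_of_weakST_pieces` from the EF-free (ST), and
`latticeMagicTarget_of_injOWF_pieces` from apex A of line `SketchIdeator5` through the landed cryptographic
leg `st_of_injOWF`, ≈ 3 500 lines): A gives an ST-hard `V`; if `Target` failed then `NP = coNP`, so some
proof system `W` for `TAUT` is polynomially bounded (Cook–Reckhow, landed); the JOIN `V ⊔ W` is then a
proof system for `TAUT` (§1: its verifier is polynomial time), still ST-hard (`stHyp_mono`), strong
(§2: a polynomially bounded complete system weakly simulates EF, by EF-soundness) and polynomially bounded,
hence with the strong feasible disjunction property (§3: a tautological disjoint disjunction has a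
tautological disjunct, `exists_isTautology_of_bigDisj`, landed) — contradicting K at M.
-/

namespace Summit.PneNP.PneNP.Cruxes.Target.KrajicekSplit

open Literature.Computability.Complexity Literature.Computability.Cryptography
open Literature.Computability.MetaComplexity
open _root_.Computability
open Literature.Analysis.FunctionSpaces (PVFun)
open Summit.PneNP.PneNP.Theorems Summit.PneNP.PneNP.Theorems.LatticeMagicTarget
open Summit.PneNP.PneNP.Theses.LatticeMagic (Target)

/-- Monotonicity of evaluation of `ℕ`-polynomials (private copy). [folklore] -/
private theorem natPoly_eval_mono (p : Polynomial ℕ) {a b : ℕ} (h : a ≤ b) : p.eval a ≤ p.eval b :=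
  TM2Iter.eval_mono p h

/-! ### 1. The join of two proof systems -/

/-- The join `V ⊔ W` of two verifiers: a proof is accepted if either system accepts it. [folklore] -/
def joinV (V W : List Bool → List Bool → Bool) (x π : List Bool) : Bool :=
  V x π || W x π

/-- The join as a one-bit string function on `⟨x, π⟩`: branch on the accept bit of `V`. [folklore] -/
noncomputable def joinFn (V W : List Bool → List Bool → Bool) : List Bool → List Bool :=
  iteFn (fun z => [V (boolUnpair z).1 (boolUnpair z).2]) (fun _ => [true])
    (fun z => [W (boolUnpair z).1 (boolUnpair z).2])

/-- `joinFn ∈ FP` for polynomial-time verifiers. [folklore] -/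
theorem joinFn_mem_FP {V W : List Bool → List Bool → Bool} (hV : IsPolyTimeVerifier V)
    (hW : IsPolyTimeVerifier W) : joinFn V W ∈ FP := by
  unfold joinFn
  exact iteFn_mem_FP (verifierFn_mem_FP hV) (const_mem_FP _) (verifierFn_mem_FP hW)

/-- Value of `joinFn` on a pair. [folklore] -/
theorem joinFn_boolPair (V W : List Bool → List Bool → Bool) (x π : List Bool) :
    joinFn V W (boolPair x π) = [joinV V W x π] := by
  unfold joinFn joinV
  cases hV : V x π with
  | true => rw [iteFn_apply_true (by simp [boolUnpair_boolPair, hV])]; simp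
  | false => rw [iteFn_apply_false (by simp [boolUnpair_boolPair, hV])]; simp [boolUnpair_boolPair]

/-- **The join of two polynomial-time verifiers is polynomial time.** [folklore] -/
theorem isPolyTimeVerifier_joinV {V W : List Bool → List Bool → Bool} (hV : IsPolyTimeVerifier V)
    (hW : IsPolyTimeVerifier W) : IsPolyTimeVerifier (joinV V W) := by
  refine (joinFn_mem_FP hV hW).of_encode (fun p : List Bool × List Bool => boolPair p.1 p.2)
    (fun _ => rfl) fun p => ?_
  obtain ⟨x, π⟩ := p
  simp only [id, joinFn_boolPair]
  rfl

/-- **The join of two proof systems for `L` is a proof system for `L`.** [folklore] -/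
theorem isProofSystemFor_joinV {L : Language Bool} {V W : List Bool → List Bool → Bool}
    (hV : IsProofSystemFor V L) (hW : IsProofSystemFor W L) : IsProofSystemFor (joinV V W) L := by
  refine ⟨isPolyTimeVerifier_joinV hV.1 hW.1, fun x => ⟨fun hx => ?_, ?_⟩⟩
  · obtain ⟨π, hπ⟩ := (hV.2 x).1 hx
    exact ⟨π, by simp [joinV, hπ]⟩
  · rintro ⟨π, hπ⟩
    simp only [joinV, Bool.or_eq_true] at hπ
    rcases hπ with hπ | hπ
    · exact (hV.2 x).2 ⟨π, hπ⟩
    · exact (hW.2 x).2 ⟨π, hπ⟩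

/-- ST-hardness passes to the join (every `V`-proof is a `V ⊔ W`-proof; `stHyp_mono`). [folklore] -/
theorem stHyp_joinV {V W : List Bool → List Bool → Bool} (h : STHyp V) : STHyp (joinV V W) :=
  stHyp_mono V (joinV V W) (fun x π hx => by simp [joinV, hx]) h

/-- The join with a polynomially bounded proof system for the same language is polynomially bounded.
[folklore] -/
theorem isPolyBounded_joinV {L : Language Bool} {V W : List Bool → List Bool → Bool}
    (hV : IsProofSystemFor V L) (hW : IsProofSystemFor W L) (hWb : IsPolyBounded W) :
    IsPolyBounded (joinV V W) := by
  obtain ⟨p, hp⟩ := hWb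
  refine ⟨p, fun x π hπ => ?_⟩
  have hx : x ∈ L := (isProofSystemFor_joinV hV hW).mem_of_eq_true hπ
  obtain ⟨π₀, hπ₀⟩ := (hW.2 x).1 hx
  obtain ⟨π', hlen, hπ'⟩ := hp x π₀ hπ₀
  exact ⟨π', hlen, by simp [joinV, hπ']⟩

/-! ### 2. A polynomially bounded complete system is strong (weakly simulates EF) -/

/-- An element's code is no longer than the code of the list (the tree's `listBool` encoding). [folklore] -/
theorem length_encode_le_length_listBool_encode {α : Type} (e : Computability.Encoding α Bool)
    {a : α} {l : List α} (ha : a ∈ l) : (e.encode a).length ≤ (e.listBool.encode l).length := by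
  change (e.encode a).length ≤
    (boolPair (unaryEncodeNat l.length) (l.foldr (fun a acc => boolPair (e.encode a) acc) [])).length
  rw [length_boolPair]
  suffices h : (e.encode a).length ≤ (l.foldr (fun a acc => boolPair (e.encode a) acc) []).length by
    omega
  induction l with
  | nil => exact absurd ha List.not_mem_nil
  | cons b l ih =>
    rw [List.foldr_cons, length_boolPair]
    rcases List.mem_cons.1 ha with rfl | hal
    · omega
    · have := ih hal
      omega

/-- **A polynomially bounded proof system for `TAUT` weakly simulates EF**: an EF-proof `π` of `φ` makes
`φ` a tautology (EF-soundness over `textbookFrege`, landed), so `φ` has a polynomially short proof in the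
system; and `|φ| ≤ |π|` since `φ` is the last line of `π`. [folklore] -/
theorem simulatesEF_of_isPolyBounded {W : List Bool → List Bool → Bool} (hW : IsProofSystemFor W TAUT)
    (hWb : IsPolyBounded W) : SimulatesEF W := by
  obtain ⟨p, hp⟩ := hWb
  refine ⟨p, fun π φ hπφ => ?_⟩
  have htaut : φ.IsTautology := isSound_textbookFrege.isTautology_of_isEFProofOf hπφ
  have hmem : encodingPropForm.encode φ ∈ TAUT := (mem_TAUT_iff φ).2 htaut
  obtain ⟨π₀, hπ₀⟩ := (hW.2 _).1 hmem
  obtain ⟨π', hlen, hπ'⟩ := hp _ π₀ hπ₀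
  refine ⟨π', le_trans hlen (natPoly_eval_mono p ?_), hπ'⟩
  exact length_encode_le_length_listBool_encode encodingPropForm (List.mem_of_getLast? hπφ.2)

/-- The join with a polynomially bounded proof system for `TAUT` is strong. [folklore] -/
theorem simulatesEF_joinV {V W : List Bool → List Bool → Bool} (hV : IsProofSystemFor V TAUT)
    (hW : IsProofSystemFor W TAUT) (hWb : IsPolyBounded W) : SimulatesEF (joinV V W) :=
  simulatesEF_of_isPolyBounded (isProofSystemFor_joinV hV hW) (isPolyBounded_joinV hV hW hWb)

/-! ### 3. A polynomially bounded complete system has the strong feasible disjunction property -/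

/-- A disjunct is no larger than the disjunction. [folklore] -/
theorem size_le_size_bigDisj {φ : PropForm ℕ} : ∀ {l : List (PropForm ℕ)}, φ ∈ l → φ.size ≤ (bigDisj l).size
  | [], h => absurd h List.not_mem_nil
  | [ψ], h => by
    rw [List.mem_singleton.1 h]
    exact le_rfl
  | ψ :: χ :: l, h => by
    rw [show bigDisj (ψ :: χ :: l) = .disj ψ (bigDisj (χ :: l)) from rfl, PropForm.size]
    rcases List.mem_cons.1 h with rfl | h
    · omega
    · have := size_le_size_bigDisj h
      omega

/-- The code of a disjunct is no longer than the code of the disjunction. [folklore] -/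
theorem length_code_le_of_mem_bigDisj {φ : PropForm ℕ} :
    ∀ {l : List (PropForm ℕ)}, φ ∈ l → φ.code.length ≤ (bigDisj l).code.length
  | [], h => absurd h List.not_mem_nil
  | [ψ], h => by
    rw [List.mem_singleton.1 h]
    exact le_rfl
  | ψ :: χ :: l, h => by
    rw [show bigDisj (ψ :: χ :: l) = .disj ψ (bigDisj (χ :: l)) from rfl, PropForm.code]
    simp only [List.length_cons, List.length_append]
    rcases List.mem_cons.1 h with rfl | h
    · omega
    · have := length_code_le_of_mem_bigDisj h
      omega

/-- The unary numeral is monotone in length. [folklore] -/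
theorem length_unaryEncodeNat_mono {m n : ℕ} (h : m ≤ n) :
    (unaryEncodeNat m).length ≤ (unaryEncodeNat n).length := by
  simp [h]

/-- The code of a disjunct of `⋁ l` is no longer than the code of `⋁ l`. [folklore] -/
theorem length_encode_le_of_mem_bigDisj {φ : PropForm ℕ} {l : List (PropForm ℕ)} (h : φ ∈ l) :
    (encodingPropForm.encode φ).length ≤ (encodingPropForm.encode (bigDisj l)).length := by
  change (boolPair (unaryEncodeNat φ.size) φ.code).length ≤
    (boolPair (unaryEncodeNat (bigDisj l).size) (bigDisj l).code).length
  rw [length_boolPair, length_boolPair]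
  have h1 := length_unaryEncodeNat_mono (size_le_size_bigDisj h)
  have h2 := length_code_le_of_mem_bigDisj h
  omega

/-- **A polynomially bounded proof system for `TAUT` has the strong feasible disjunction property**:
a provable disjoint disjunction is a tautology (soundness), so one of its variable-disjoint disjuncts is
(`exists_isTautology_of_bigDisj`), and that disjunct has a polynomially short proof. [folklore] -/
theorem strongFDP_of_isPolyBounded {W : List Bool → List Bool → Bool} (hW : IsProofSystemFor W TAUT)
    (hWb : IsPolyBounded W) : StrongFDP W := by
  obtain ⟨p, hp⟩ := hWb
  refine ⟨p, fun I => ?_⟩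
  obtain ⟨φ, hφ, hφt⟩ := SqueezeVacuity.exists_isTautology_of_bigDisj I.disjoint
    ((mem_TAUT_iff _).1 (hW.mem_of_eq_true I.proves))
  obtain ⟨π₀, hπ₀⟩ := (hW.2 _).1 ((mem_TAUT_iff φ).2 hφt)
  obtain ⟨π', hlen, hπ'⟩ := hp _ π₀ hπ₀
  refine ⟨φ, hφ, π', le_trans hlen (natPoly_eval_mono p ?_), hπ'⟩
  have := length_encode_le_of_mem_bigDisj (l := I.l) hφ
  omega

/-! ### 4. The assembly: the pieces give the crux -/

/-- **`Target` from the pieces, core form** — an ST-hard Cook–Reckhow proof system for `TAUT` (the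
EF-free form of Hypothesis (ST): what the landed cryptographic leg `st_of_injOWF` delivers), MEP
(Krajíček's Problem 3.2) and Krajíček's Thm 4.1 in its strong form (MEP ⟹ no strong proof system with an
ST-hard `DD` problem has the strong feasible disjunction property) give `Target`. Proof = step (1) of the
proof of Thm 4.1: were `Target` false, `NP = coNP` would give a polynomially bounded proof system `W` for
`TAUT` (Cook–Reckhow, landed), and the join of the ST-witness with `W` would be a strong, ST-hard,
polynomially bounded proof system — which has the strong feasible disjunction property, against Thm 4.1.
[cite: Krajicek2025Squeeze, Thm. 4.1 and §4 (closing remark)] -/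
theorem latticeMagicTarget_of_weakST_pieces
    (hA : ∃ V : List Bool → List Bool → Bool, IsProofSystemFor V TAUT ∧ STHyp V)
    (hM : ModelExtensionProperty)
    (hK : ModelExtensionProperty → ∀ V : List Bool → List Bool → Bool,
      IsProofSystemFor V TAUT → SimulatesEF V → STHyp V → ¬ StrongFDP V) :
    Target := by
  obtain ⟨V, hV, hST⟩ := hA
  by_contra hT
  have hpb : HasPolyBoundedProofSystem TAUT := by
    by_contra hnpb
    exact hT (latticeMagicTarget_iff_not_hasPolyBoundedProofSystem_TAUT.2 hnpb)
  obtain ⟨W, hW, hWb⟩ := hpb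
  exact hK hM (joinV V W) (isProofSystemFor_joinV hV hW) (simulatesEF_joinV hV hW hWb)
    (stHyp_joinV hST) (strongFDP_of_isPolyBounded (isProofSystemFor_joinV hV hW)
      (isPolyBounded_joinV hV hW hWb))

/-- **`Target` from the three route pieces** — Hypothesis (ST) VERBATIM (a STRONG proof system with an
ST-hard `DD` problem: the route item `HypothesisST`, definiens of `StrongST`), MEP (`KrajicekMEP`) and
Thm 4.1 in strong form (`KrajicekSqueeze`). This is the statement of the route's glue item
`HypothesisST → KrajicekMEP → KrajicekSqueeze → Target`, up to unfolding the route decls.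
[cite: Krajicek2025Squeeze, Thm. 4.1] -/
theorem latticeMagicTarget_of_pieces
    (hA : ∃ V : List Bool → List Bool → Bool, IsProofSystemFor V TAUT ∧ SimulatesEF V ∧ STHyp V)
    (hM : ModelExtensionProperty)
    (hK : ModelExtensionProperty → ∀ V : List Bool → List Bool → Bool,
      IsProofSystemFor V TAUT → SimulatesEF V → STHyp V → ¬ StrongFDP V) :
    Target := by
  obtain ⟨V, hV, -, hST⟩ := hA
  exact latticeMagicTarget_of_weakST_pieces ⟨V, hV, hST⟩ hM hK

/-- **`Target` from apex A of line `SketchIdeator5`** (an injective one-way family with a hard-core bit,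
through the landed cryptographic leg `st_of_injOWF`) and the two new pieces. [cite: Krajicek2025Squeeze, Lemma 2.2 and Thm. 4.1] -/
theorem latticeMagicTarget_of_injOWF_pieces
    (hA : ∃ (g : List Bool → List Bool) (B : List Bool → Bool),
      InjOnLengths g ∧ IsLengthRegular g ∧ IsOneWay g ∧ IsHardCorePredicate B g)
    (hM : ModelExtensionProperty)
    (hK : ModelExtensionProperty → ∀ V : List Bool → List Bool → Bool,
      IsProofSystemFor V TAUT → SimulatesEF V → STHyp V → ¬ StrongFDP V) :
    Target :=
  latticeMagicTarget_of_weakST_pieces (st_of_injOWF hA) hM hK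

/-! ### 5. Book-keeping: what the pieces are worth (no new facts) -/

/-- PRICE TAG of piece A, restated next to the assembly: Hypothesis (ST) alone refutes `TAUT ∈ P`
(landed `stHyp_false_of_TAUT_mem_P`), hence proves `P ≠ NP` and the summit `PneNP` (landed
`Target.Negative.pneNP_of_stHyp`, not imported here to keep the cone small). The split is a decomposition
of the crux's SURPLUS `NP ≠ coNP` over `P ≠ NP`, not a non-circular way to the summit. [folklore] -/
theorem TAUT_not_mem_P_of_pieceA
    (hA : ∃ V : List Bool → List Bool → Bool, IsProofSystemFor V TAUT ∧ SimulatesEF V ∧ STHyp V) :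
    TAUT ∉ Classes.P := by
  obtain ⟨V, hV, -, hST⟩ := hA
  exact fun hT => stHyp_false_of_TAUT_mem_P V hV hT hST

/-- Piece K is implied by `TAUT ∈ P` (then no proof system for `TAUT` is ST-hard, `stHyp_false_of_TAUT_mem_P`):
like every statement about ST-hard systems it is void under `P = NP` — its content is Krajíček's theorem,
to be had by formalising KPT witnessing over `T_PV` and the propositional translation. [folklore] -/
theorem pieceK_of_TAUT_mem_P (hT : TAUT ∈ Classes.P) :
    ModelExtensionProperty → ∀ V : List Bool → List Bool → Bool,
      IsProofSystemFor V TAUT → SimulatesEF V → STHyp V → ¬ StrongFDP V :=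
  fun _ V hV _ hST _ => stHyp_false_of_TAUT_mem_P V hV hT hST

/-! ### 6. THE LINE: registered stubs = the three pieces; the composition closes the crux BY NAME -/

/-- **PIECE A (stub; conjecture-grade, route item `HypothesisST`).** Krajíček's Hypothesis (ST), verbatim:
a strong (EF-simulating) Cook–Reckhow proof system for `TAUT` whose disjoint-disjunction problem `DD_V` is
hard for `FP` students with `O(1)` rounds. Evidence: Lemma 2.2 of arXiv:2506.20221 (one-way permutations);
in the tree the EF-free form follows from an injective one-way family with a hard-core bit (`st_of_injOWF`,
landed) — the EF-simulation clause then needs an EF Cook–Reckhow verifier (birth skeleton of the piece).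
PRICE TAG: implies `TAUT ∉ P`, hence the summit (`TAUT_not_mem_P_of_pieceA`; `Target.Negative.pneNP_of_stHyp`).
[cite: Krajicek2025Squeeze, §2 Hypothesis (ST) and Lemma 2.2] -/
theorem stub_hypothesisST :
    ∃ V : List Bool → List Bool → Bool, IsProofSystemFor V TAUT ∧ SimulatesEF V ∧ STHyp V := by
  sorry

/-- **PIECE M (stub; OPEN PROBLEM, route item `KrajicekMEP`).** The model-extension property for `T_PV`
= the affirmative answer to Krajíček's Problem 3.2 (`ModelExtensionProperty` above, typed over the tree's
`trueUnivPV`). Known for models of `S¹₂(PV)` (Krajíček–Pudlák 1990 via sharply bounded collection) — the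
piece's birth skeleton reduces the general case to that one. Its NEGATION implies `P ≠ NP`.
[cite: Krajicek2025Squeeze, Problem 3.2] -/
theorem stub_MEP : ModelExtensionProperty := by
  sorry

/-- **PIECE K (stub; THEOREM IN PRINT, route item `KrajicekSqueeze`, support-grade).** Krajíček's Thm 4.1
with the closing remark of its proof: MEP ⟹ no strong Cook–Reckhow proof system for `TAUT` with an ST-hard
`DD` problem has the strong feasible disjunction property. To prove it in the tree: KPT witnessing for the
universal theory `T_PV` + the axioms of a `DD_V`-instance (step 2), the propositional translation `‖·‖` of
sharply bounded `L(PV)`-formulas and the claim `A_Q ∈ T_PV` (steps 3–4), and the decoding of a falsifying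
assignment through `Log(M*) = Log(M')` and `Σᵇ₁`-preservation against `Ref_V ∈ T_PV` (step 5).
[cite: Krajicek2025Squeeze, Thm. 4.1 and §4 (closing remark)] -/
theorem stub_thm41 : ModelExtensionProperty → ∀ V : List Bool → List Bool → Bool,
    IsProofSystemFor V TAUT → SimulatesEF V → STHyp V → ¬ StrongFDP V := by
  sorry

/-- **The line closes the crux (modulo its stubs)**: `Target` BY NAME. -/
theorem Target_of : Summit.PneNP.PneNP.Theses.LatticeMagic.Target :=
  latticeMagicTarget_of_pieces stub_hypothesisST stub_MEP stub_thm41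

end Summit.PneNP.PneNP.Cruxes.Target.KrajicekSplit
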